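import Literature.MathematicalPhysics.QuantumFieldTheory.Balaban1983to89.B9TorusCalculus
import Literature.MathematicalPhysics.QuantumFieldTheory.Balaban1983to89.B12RegularSpaces111

/-!
# `Balaban1983to89.B12Eq18Current` — T. Bałaban, *Renormalization group approach to lattice gauge field theories. I*,
Commun. Math. Phys. **109** (1987) 249–301 [Balaban1987RG1]: the current (1.8) p. 261, `J_j = D^{ξ*}_{U_j} ξ⁻² π Im ∂U_j`,
CONCRETE on the carriers of record (the bond configurations of `Setup`, the covariant divergence `D^{ξ*}` of
[Balaban1985BackgroundPropagators] (3.9) = `B9Eq39Adjoint.divPη` on the torus datum `B9TorusCalculus.torusT`, `Im` = `B9Eq37Insertion.imC`,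
the plaquette variables of `B12RegularSpaces111`), WITH the printed projection `π` onto `𝔤ᶜ`; PROVED: gauge covariance
`J(𝐔^u) = R(u)J(𝐔)`, hence the substitution (1.9) `𝐔 ↦ (𝐔, J(𝐔))` intertwines the gauge action (1.10), and the p. 263 implication
«(1.10)-invariance of 𝐄^{(j)}(X, 𝐔, 𝐉) ⇒ gauge invariance of U ↦ 𝐄^{(j)}(X, U, J(U))»; `J` is `𝔤ᶜ`-valued

HONEST FRAMING (cell `lit-balaban`, verbatim): statement-level skeleton of published theorems with citation tags; proofs where landed; nothing here is a claim about the Yang–Mills mass gap.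

PDF held: `paper:balaban1987-cmp109-rg-i-small-field` (journal page = PDF page + 248); read from the page renders
`b2b-balaban-ref1/pages/1987-cmp109-rg-I-small-field/…-p013-x2.png` (p. 261), `…-p014-x2.png` (p. 262), `…-p015-x2.png` (p. 263),
as images.

WHAT IS REPRODUCED.  SKELETON row `B12.Eq1.8` («J_j = D^{ξ*}_{U_j} ξ^{−2}π Im ∂U_j (π = projection onto 𝔤ᶜ, Im U = (U − U⁻¹)/2i)»,
status «typed-existing · ABSTRACT carrier only (concrete object not constructed); concrete D^{ξ*} absent — INTERFACE B8/B9», owner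
r09/r20, `INTERFACES-r09` I-r09-1) — until now carried by the abstract field `Step.SFTower.ofBackground` («U ↦ (U, J(U))»), while
the concrete current WITHOUT `π` exists on the abstract finite lattice of [15] (`B9Eq39Adjoint.J` = (3.11) [15], `B11Eq27Current`)
and on the tori (`B9TorusCalculus.J_gaugeTr`, `divB_J_eq_zero`).

THE PRINT, verbatim.  p. 261: *«For technical reasons it is convenient to separate the dependence on the second order derivative.
From the previous papers it is clear that it appears only in the functions  J_j = D^{ξ*}_{U_j} ξ⁻² π Im ∂U_j, (1.8)  where π denotes the
projection in the space of all complex N × N-matrices onto the algebra 𝔤ᶜ, and Im U = (1/2i)(U − U⁻¹). They appear in expansions of the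
action, and in expressions defining propagators. We extend the terms in (1.7) introducing two variables 𝐔, 𝐉, the second variable
replacing the functions (1.8), and the first satisfying milder regularity conditions involving first order derivatives at most. Thus we
assume that there are functions 𝐄^{(j)}(X, g_{j−1}, 𝐔, 𝐉), analytic on a space of regular, complex configurations 𝐔, 𝐉, such that
𝐄^{(j)}(X, g_{j−1}, U_j) = 𝐄^{(j)}(X, g_{j−1}, U_j, J_j). (1.9)»*  p. 262: *«A Gᶜ-valued gauge transformation u acts on pairs (𝐔, 𝐉) in the
following way (𝐔, 𝐉)^u = (𝐔^u, R(u)𝐉) = (u₋𝐔u₊⁻¹, R(u₋)𝐉), (1.10)»*.  p. 263: *«We assume that all functions 𝐄^{(j)}(X, g_{j−1}, 𝐔, 𝐉) are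
gauge invariant with respect to the group of all gauge transformations (1.10). … These assumptions imply that the action A_k(U) … is
gauge invariant with respect to all G-valued transformations.»*  [15] = [Balaban1985BackgroundPropagators] (3.30) p. 395: the current
of the transformed background is the rotated current, `J^u = R(u)J`.

THE TYPING (carriers OF RECORD, nothing re-declared).  A `Gᶜ`-valued configuration `𝐔 : PBond P i → 𝔸ˣ` of `Setup` (as in
`B12RegularSpaces111`) is read as the direction-indexed family `dirForm 𝐔 : Fin P.d → Site P i → 𝔸ˣ` of the B9 calculus
(`B9Eq39Adjoint`: `R(g)X = gXg⁻¹`, `D*_μ` = `covDstar`, `D*` on plaquette functions = `divP`, `D^{ξ*} = ξ⁻¹D*` = `divPη`, `∂𝐔(p)` =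
`plaqU`; shifts = `B9TorusCalculus.torusT`, whose plaquettes close: `torusT_comm`); `∂𝐔(p)` there IS `B12RegularSpaces111.plaq 𝐔 p`
(`plaq_eq_plaqU`, `rfl`) and `𝐔^u` there IS `B9Eq3117Current.gaugeTr` (`dirForm_gaugeU`, `rfl`).  The projection `π` is a `ℂ`-linear map
`𝔸 →ₗ[ℂ] 𝔸` (DATA: the printed projection onto `𝔤ᶜ`; its two printed-context properties — commuting with the adjoint action of the gauge
group, values in `𝔤ᶜ` — are the hypotheses `hπ` of the theorems that need them).  **`current π ξ 𝐔`** = (1.8) as a bond function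
`PBond P i → 𝔸`; `imPlaq` = the plaquette function `ξ⁻² π Im ∂𝐔`; `ofBackground π ξ 𝐔 = (𝐔, J(𝐔))` = the substitution of (1.9).
PROVED: `current_id_eq_J` (for `π = id` — `G = U(N)`, `𝔤ᶜ = M_N(ℂ)` — (1.8) IS the current (3.11) of [15], `B9Eq39Adjoint.J`),
`imPlaq_gaugeU`, **`current_gaugeU`** (`J(𝐔^u)(b) = R(u(b₋))J(𝐔)(b)`, from `B9Eq3117Current.plaqU_gaugeTr`/`imC_conj`/`divP_gaugeTr`),
`current_gaugeU_eq_adJ` (the same in the letters of (1.10): `J(𝐔^u) = R(u)J(𝐔)` = `B12RegularSpaces111.adJ`), **`ofBackground_gaugeU`**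
(`(𝐔^u, J(𝐔^u)) = (𝐔, J(𝐔))^u`: (1.9)'s substitution intertwines (1.10)), **`invariant_comp_ofBackground`** (p. 263: a function of pairs
invariant under (1.10) gives a gauge-invariant function of `U` after the substitution (1.9)), `current_mem_gc` («𝐉 … has values in 𝔤ᶜ»:
for `π` with values in `𝔤ᶜ`, `𝔤ᶜ` stable under `Ad(Gᶜ)`, `𝐔` `Gᶜ`-valued).  NOT here: `D^{ξ*}J = 0` with `π` ((3.117) [15] is
`B9TorusCalculus.divB_J_eq_zero` for `π = id`), the bound (1.14)/(1.16) on `J` (row B12.Eq1.17, Proposition 9 [15]), the minimizers `U_j`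
themselves (data elsewhere).  No `Prop` placeholder, no new fact; axioms standard.  Unit `lit-balaban-p07` (Phase-2 seat p07 gen 3;
TAKING line HOME/STATUS.md 2026-08-21T04:52:00Z), HOME `run/shared/lean/pub/lit-balaban/`.
-/

namespace Literature.MathematicalPhysics.QuantumFieldTheory.Balaban1983to89.B12Eq18Current

open Literature.MathematicalPhysics.QuantumFieldTheory.Balaban1983to89
open Literature.MathematicalPhysics.QuantumFieldTheory.Balaban1983to89.B9Eq39Adjoint
open Literature.MathematicalPhysics.QuantumFieldTheory.Balaban1983to89.B9TorusCalculus
open Literature.MathematicalPhysics.QuantumFieldTheory.Balaban1983to89.B12RegularSpaces111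
open Complex

noncomputable section

/-! ## §1. Dictionary: `Setup` bond configurations as the direction-indexed families of the calculus of [15] -/

section Dictionary

variable {P : Params} {i : ℕ}

/-- A bond configuration `𝐔(b)`, `b = ⟨x, x + e_μ⟩`, read as the family `μ ↦ x ↦ 𝐔(x, x + e_μ)` of [15] §A («U μ x = U(x, x+e_μ)»).
[cite: Balaban1985BackgroundPropagators, (3.1) p.390] -/
def dirForm {M : Type*} (U : PBond P i → M) : Fin P.d → Site P i → M := fun μ x => U ⟨x, μ⟩

/-- Unfolding `dirForm`. [cite: Balaban1985BackgroundPropagators, (3.1) p.390] -/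
@[simp] theorem dirForm_apply {M : Type*} (U : PBond P i → M) (μ : Fin P.d) (x : Site P i) : dirForm U μ x = U ⟨x, μ⟩ := rfl

/-- The torus shift datum is `x ↦ x + e_μ`. [cite: Balaban1985BackgroundPropagators, (3.1) p.390] -/
theorem torusT_apply (μ : Fin P.d) (x : Site P i) : torusT P i μ x = x.shift μ := rfl

variable {𝔸 : Type*} [Ring 𝔸]

/-- The plaquette variable `∂𝐔(p)` of `B12RegularSpaces111` IS the `U(∂p)` of the B9 calculus on the torus datum.
[cite: Balaban1987RG1, (1.11) p.262] -/
theorem plaq_eq_plaqU (U : PBond P i → 𝔸ˣ) (p : Plaq P i) :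
    plaq U p = plaqU (torusT P i) (dirForm U) p.μ p.ν p.src := rfl

/-- The gauge action `𝐔 ↦ 𝐔^u = u₋𝐔u₊⁻¹` of (1.10) IS `B9Eq3117Current.gaugeTr` on the torus datum ([15] (3.28)).
[cite: Balaban1987RG1, (1.10) p.262] -/
theorem dirForm_gaugeU (u : Site P i → 𝔸ˣ) (U : PBond P i → 𝔸ˣ) :
    dirForm (gaugeU u U) = B9Eq3117Current.gaugeTr (torusT P i) u (dirForm U) := rfl

/-- `R(u₋)𝐉` of (1.10) IS `R (u b₋) (𝐉 b)` of the B9 calculus. [cite: Balaban1987RG1, (1.10) p.262] -/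
theorem adJ_apply_eq_R (u : Site P i → 𝔸ˣ) (J : PBond P i → 𝔸) (b : PBond P i) : adJ u J b = R (u b.src) (J b) := rfl

end Dictionary

/-! ## §2. (1.8): the current `J = D^{ξ*}_𝐔 ξ⁻² π Im ∂𝐔` -/

section Current

variable {P : Params} {i : ℕ} {𝔸 : Type*} [Ring 𝔸] [Algebra ℂ 𝔸]

/-- The plaquette function `ξ⁻² π Im ∂𝐔` of (1.8): «Im U = (1/2i)(U − U⁻¹)» (= `B9Eq37Insertion.imC`), `π` the projection onto `𝔤ᶜ`.
[cite: Balaban1987RG1, (1.8) p.261] -/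
def imPlaq (π : 𝔸 →ₗ[ℂ] 𝔸) (ξ : ℝ) (U : PBond P i → 𝔸ˣ) : Fin P.d → Fin P.d → Site P i → 𝔸 :=
  fun μ ν x => (((ξ : ℂ)⁻¹) ^ 2) • π (B9Eq37Insertion.imC (plaqU (torusT P i) (dirForm U) μ ν x))

/-- **(1.8)**: the current `J(𝐔) = D^{ξ*}_𝐔 ξ⁻² π Im ∂𝐔` of a configuration `𝐔`, as a bond function — `D^{ξ*} = ξ⁻¹D*`, `D*` the adjoint
of the covariant curl acting on plaquette functions ([15] (3.9), `B9Eq39Adjoint.divPη`), evaluated at the bond `b = ⟨b₋, b₋ + e_μ⟩`.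
[cite: Balaban1987RG1, (1.8) p.261] -/
def current (π : 𝔸 →ₗ[ℂ] 𝔸) (ξ : ℝ) (U : PBond P i → 𝔸ˣ) : PBond P i → 𝔸 :=
  fun b => divPη (torusT P i) (dirForm U) ξ (imPlaq π ξ U) b.dir b.src

/-- The printed word of (1.8) at a bond. [cite: Balaban1987RG1, (1.8) p.261] -/
theorem current_apply (π : 𝔸 →ₗ[ℂ] 𝔸) (ξ : ℝ) (U : PBond P i → 𝔸ˣ) (b : PBond P i) :
    current π ξ U b = ((ξ : ℂ)⁻¹) • divP (torusT P i) (dirForm U) (imPlaq π ξ U) b.dir b.src := rfl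

/-- For `π = id` (`G = U(N)`, `𝔤ᶜ` = all matrices) the current (1.8) IS the current `J = D*η⁻² Im ∂U` of [15] (3.11) / (28) of
[Balaban1985Variational] on the torus (`B9Eq39Adjoint.J`). [cite: Balaban1987RG1, (1.8) p.261] -/
theorem current_id_eq_J (ξ : ℝ) (U : PBond P i → 𝔸ˣ) (b : PBond P i) :
    current LinearMap.id ξ U b = J (torusT P i) (dirForm U) ξ b.dir b.src := rfl

/-! ## §3. Gauge covariance of the current: `J(𝐔^u) = R(u)J(𝐔)` -/

/-- `ξ⁻² π Im ∂(𝐔^u)(p) = R(u(x)) ξ⁻² π Im ∂𝐔(p)` at the base point `x` of `p`, for `π` commuting with the adjoint action of the values of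
`u` (plaquette covariance [15] (3.28)–(3.29): `B9Eq3117Current.plaqU_gaugeTr`, `imC_conj`). [cite: Balaban1987RG1, (1.10) p.262] -/
theorem imPlaq_gaugeU (π : 𝔸 →ₗ[ℂ] 𝔸) (ξ : ℝ) (u : Site P i → 𝔸ˣ) (hπ : ∀ x X, π (R (u x) X) = R (u x) (π X))
    (U : PBond P i → 𝔸ˣ) :
    imPlaq π ξ (gaugeU u U) = fun μ ν x => R (u x) (imPlaq π ξ U μ ν x) := by
  funext μ ν x
  simp only [imPlaq, dirForm_gaugeU]
  rw [B9Eq3117Current.plaqU_gaugeTr (torusT P i) (dirForm U) torusT_comm, B9Eq3117Current.imC_conj, hπ, R_smul]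

/-- **Gauge covariance of (1.8)**: `J(𝐔^u)(b) = R(u(b₋)) J(𝐔)(b)` — the current of the transformed configuration is the rotated
current ([15] (3.30) `J^u = R(u)J`, here with the projection `π`, for `π` commuting with the adjoint action of the values of `u`).
[cite: Balaban1987RG1, (1.10) p.262] -/
theorem current_gaugeU (π : 𝔸 →ₗ[ℂ] 𝔸) (ξ : ℝ) (u : Site P i → 𝔸ˣ) (hπ : ∀ x X, π (R (u x) X) = R (u x) (π X))
    (U : PBond P i → 𝔸ˣ) (b : PBond P i) :
    current π ξ (gaugeU u U) b = R (u b.src) (current π ξ U b) := by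
  rw [current_apply, current_apply, imPlaq_gaugeU π ξ u hπ, dirForm_gaugeU, B9Eq3117Current.divP_gaugeTr, R_smul]

/-- The same in the letters of (1.10): `J(𝐔^u) = R(u)J(𝐔)` with `R(u)𝐉 = B12RegularSpaces111.adJ u 𝐉`.
[cite: Balaban1987RG1, (1.10) p.262] -/
theorem current_gaugeU_eq_adJ (π : 𝔸 →ₗ[ℂ] 𝔸) (ξ : ℝ) (u : Site P i → 𝔸ˣ) (hπ : ∀ x X, π (R (u x) X) = R (u x) (π X))
    (U : PBond P i → 𝔸ˣ) : current π ξ (gaugeU u U) = adJ u (current π ξ U) := by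
  funext b
  rw [current_gaugeU π ξ u hπ, adJ_apply_eq_R]

/-! ## §4. (1.9): the substitution `𝐔 ↦ (𝐔, J(𝐔))` and the gauge action (1.10) -/

/-- The substitution of (1.9): «the second variable replacing the functions (1.8)» — the pair `(𝐔, J(𝐔))` (the concrete content of the
abstract `Step.SFTower.ofBackground`). [cite: Balaban1987RG1, (1.9) p.261] -/
def ofBackground (π : 𝔸 →ₗ[ℂ] 𝔸) (ξ : ℝ) (U : PBond P i → 𝔸ˣ) : FieldPair P i 𝔸ˣ 𝔸 where
  U := U
  J := current π ξ U

/-- The components of the substituted pair. [cite: Balaban1987RG1, (1.9) p.261] -/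
@[simp] theorem ofBackground_U (π : 𝔸 →ₗ[ℂ] 𝔸) (ξ : ℝ) (U : PBond P i → 𝔸ˣ) : (ofBackground π ξ U).U = U := rfl

/-- The components of the substituted pair. [cite: Balaban1987RG1, (1.9) p.261] -/
@[simp] theorem ofBackground_J (π : 𝔸 →ₗ[ℂ] 𝔸) (ξ : ℝ) (U : PBond P i → 𝔸ˣ) :
    (ofBackground π ξ U).J = current π ξ U := rfl

/-- **(1.9) intertwines (1.10)**: `(𝐔^u, J(𝐔^u)) = (𝐔^u, R(u)J(𝐔)) = (𝐔, J(𝐔))^u` (for `π` commuting with the adjoint action of the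
values of `u`). [cite: Balaban1987RG1, (1.10) p.262] -/
theorem ofBackground_gaugeU (π : 𝔸 →ₗ[ℂ] 𝔸) (ξ : ℝ) (u : Site P i → 𝔸ˣ) (hπ : ∀ x X, π (R (u x) X) = R (u x) (π X))
    (U : PBond P i → 𝔸ˣ) : ofBackground π ξ (gaugeU u U) = act u (ofBackground π ξ U) := by
  simp only [ofBackground, act, current_gaugeU_eq_adJ π ξ u hπ]

/-- **p. 263: «These assumptions imply that the action … is gauge invariant»** — the mechanism: a function `E` of pairs `(𝐔, 𝐉)`
invariant under the action (1.10) of a gauge transformation `u` (for whose values `π` commutes with the adjoint action) gives, after the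
substitution (1.9) `U ↦ E(U, J(U))`, a function invariant under `U ↦ U^u`. [cite: Balaban1987RG1, (1.19) p.263] -/
theorem invariant_comp_ofBackground {α : Sort*} (E : FieldPair P i 𝔸ˣ 𝔸 → α) (π : 𝔸 →ₗ[ℂ] 𝔸) (ξ : ℝ)
    (u : Site P i → 𝔸ˣ) (hπ : ∀ x X, π (R (u x) X) = R (u x) (π X)) (hE : ∀ Φ, E (act u Φ) = E Φ)
    (U : PBond P i → 𝔸ˣ) : E (ofBackground π ξ (gaugeU u U)) = E (ofBackground π ξ U) := by
  rw [ofBackground_gaugeU π ξ u hπ, hE]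

/-- The same for a family of gauge transformations (e.g. all `G`-valued ones): invariance of `E` under (1.10) for every `u` of the family
implies invariance of `U ↦ E(U, J(U))` under every `u` of the family. [cite: Balaban1987RG1, (1.19) p.263] -/
theorem invariant_comp_ofBackground_of_family {α : Sort*} (E : FieldPair P i 𝔸ˣ 𝔸 → α) (π : 𝔸 →ₗ[ℂ] 𝔸) (ξ : ℝ)
    (𝒰 : Set (Site P i → 𝔸ˣ)) (hπ : ∀ u ∈ 𝒰, ∀ x X, π (R (u x) X) = R (u x) (π X))
    (hE : ∀ u ∈ 𝒰, ∀ Φ, E (act u Φ) = E Φ) :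
    ∀ u ∈ 𝒰, ∀ U : PBond P i → 𝔸ˣ, E (ofBackground π ξ (gaugeU u U)) = E (ofBackground π ξ U) :=
  fun u hu U => invariant_comp_ofBackground E π ξ u (hπ u hu) (hE u hu) U

/-! ## §5. «𝐉 … has values in 𝔤ᶜ»: the current is `𝔤ᶜ`-valued -/

/-- `D*_μ` preserves `𝔤ᶜ`-valuedness when `𝔤ᶜ` is stable under the adjoint action of the (inverses of the) values of `𝐔`. [folklore] -/
private theorem covDstar_mem {gc : Submodule ℂ 𝔸} {V : Fin P.d → Site P i → 𝔸ˣ}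
    (hV : ∀ μ x, ∀ X ∈ gc, R (V μ x)⁻¹ X ∈ gc) {G : Site P i → 𝔸} (hG : ∀ x, G x ∈ gc) (μ : Fin P.d)
    (x : Site P i) : covDstar (torusT P i) V μ G x ∈ gc :=
  gc.sub_mem (hV _ _ _ (hG _)) (hG x)

/-- **«the configuration 𝐉 … has values in 𝔤ᶜ»** (p. 262) for `𝐉 = J(𝐔)`: if `π` takes values in `𝔤ᶜ`, `𝔤ᶜ` is stable under `Ad(Gᶜ)`,
and `𝐔` is `Gᶜ`-valued, then the current (1.8) is `𝔤ᶜ`-valued (letters of `B12RegularSpaces111.Model`). [cite: Balaban1987RG1, (1.10) p.262] -/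
theorem current_mem_gc (𝓜 : Model 𝔸) (π : 𝔸 →ₗ[ℂ] 𝔸) (hπ : ∀ X, π X ∈ 𝓜.gc)
    (hgc : ∀ g ∈ 𝓜.Gc, ∀ X ∈ 𝓜.gc, R g X ∈ 𝓜.gc) (ξ : ℝ) {U : PBond P i → 𝔸ˣ} (hU : ∀ b, U b ∈ 𝓜.Gc)
    (b : PBond P i) : current π ξ U b ∈ 𝓜.gc := by
  have hV : ∀ μ x, ∀ X ∈ 𝓜.gc, R (dirForm U μ x)⁻¹ X ∈ 𝓜.gc := fun μ x X hX =>
    hgc _ (𝓜.Gc.inv_mem (hU ⟨x, μ⟩)) X hX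
  have hF : ∀ μ ν x, imPlaq π ξ U μ ν x ∈ 𝓜.gc := fun μ ν x => 𝓜.gc.smul_mem _ (hπ _)
  rw [current_apply]
  refine 𝓜.gc.smul_mem _ (𝓜.gc.sub_mem ?_ ?_)
  · refine Submodule.sum_mem _ fun ν _ => ?_
    split_ifs
    · exact covDstar_mem hV (fun x => hF _ _ x) _ _
    · exact 𝓜.gc.zero_mem
  · refine Submodule.sum_mem _ fun ν _ => ?_
    split_ifs
    · exact covDstar_mem hV (fun x => hF _ _ x) _ _
    · exact 𝓜.gc.zero_mem

end Current

end

end Literature.MathematicalPhysics.QuantumFieldTheory.Balaban1983to89.B12Eq18Current
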